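import Literature.MathematicalPhysics.QuantumFieldTheory.Balaban1983to89.B9Thm37GlueTorusCovCT

/-!
# Literature: Bałaban's propagators for lattice gauge theories [B9] — the SUP-NORM, LOCALIZED-SOURCE form of the
decay of (Δ_U + a·Q_UᵀQ_U)⁻¹, uniform in the transport and in the volume (pv21 node HOM-PU-COVSUP; MODEL)

Sources (bib keys):
* [B9] = `Balaban1985BackgroundPropagators` — T. Bałaban, *Propagators for lattice gauge theories in a background
  field*, Commun. Math. Phys. 99 (1985) 389–434.
* [B4] = `Balaban1983RegularityDecay` — T. Bałaban, *Regularity and decay of lattice Green's functions*, Commun.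
  Math. Phys. 89 (1983) 571–597, its Sect. 5 (a general theorem on unit lattice operators) (context only: the torus
  row sums `B4Sect5Torus.torusSum_le` with the constant `B4Sect5Proof.latticeConst` K_d(κ) = (2(1 − e^{−κ/d})⁻¹)^d
  are KERNEL theorems of this directory's files on that section, reused BY NAME; nothing of [B4] is quoted or
  asserted here; v1/v1.1 of this bullet mis-keyed these files to *Propagators … I*, CMP 95 — corrected in v1.2).

THE PRINTED LOCI.  NO new «» span in this file.  Context, quoted in the headers/docstrings of modules this file
imports: [B9] (3.18)–(3.19) p. 393 (the one-step covariant averaging; `B9Thm37GlueTorusCov`), (3.3) pp. 390–391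
(∇_U; `B9Thm37Glue`), (3.23)–(3.24) p. 394 (Δ′_a = Δ_U + Q′\*aQ′; `B9Thm37Glue`), p. 395 (positivity of Δ′_a under
a regularity assumption on U; `B9Thm37Glue`, `B9Thm37GlueTorusInv`), and Theorem 3.1 with its display (3.42) p. 397
(`B9Thm37Glue`, `B9Thm37GlueTorusCovCT`).  The SHAPE of the first two of the FOUR pointwise inequalities of
(3.42), paraphrased from the page text and from this directory's rendering of Theorem 3.1 (`B9.KernelFamily`,
`B9.pref4`; no quotation): for y ∈ Λ_j, x in the cube Δ(y) and λ supported in the cube Δ(y′), the four quantities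
|(G′(U)λ)(x)|, |(∇_U G′(U)λ)(x)|, |(G′(U)∇\*_U λ)(x)|, |(Δ_U G′(U)λ)(x)| are bounded by B₀ times the SCALE PREFACTOR
(L^jη)², L^jη, L^jη, 1 respectively, times e^{−δ₀d(y,y′)}·|λ|, with |λ| the supremum norm (3.39) and δ₀, B₀
depending on d and L only — SUPREMUM-NORM bounds with a LOCALIZED SOURCE and exponential decay in the (weighted,
multiscale) distance d(y, y′) between the source cube and the evaluation cube, stated for M ≥ M₁, for
configurations U satisfying the regularity condition (3.35) with Mα₀ ≤ a₀, and for the operator G′(U) with a = 1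
(the constants M₁, δ₀, a₀, B₀ depending on d and L only).  (v1 of this header omitted the scale prefactors and
miscounted the entries of (3.42) as three — corrected by v1.1 p190532; v1.2 = this DOCFIX, docstring-only: the [B4]
bib key above, print's side conditions M ≥ M₁, Mα₀ ≤ a₀, a = 1 named here, and the distance remark of HONEST SCOPE
below corrected — executing the cross-read of v1 (journal l.56098, GAPS C-pv04g19-6); all declarations and
statements unchanged since v1.)

THE POINT.  `B9Thm37GlueTorusCovCT.entry_decay_torus_explicit` (p190149) is the ENTRYWISE decay of the inverse of
the lineage's one-step covariant model on the torus: |(Δ_U + a·Q_UᵀQ_U)⁻¹(p, p₀)| ≤ (2/σ_T)·e^{−θ_T·dist(p₀, p)}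
with σ_T = `sigmaTorus`, θ_T = `thetaTorus` > 0 depending on (d, M₀, a, c_min, c_max, w_min, w_max) only.  This
file turns it into the (3.42)-SHAPED statements for the model — supremum norm, localized source, exponential decay
in the distance from the source's support, and the same for the covariant derivative of the solution — with
constants that see neither the torus nor the transport:

* §1 (any finite index set St × Cp) the row-sum domination |(Gf)(p)| ≤ Σ_{p′} |f(p′)|·B(p′) of an endomorphism
  under an entrywise bound |(Gδ_{p′})(p)| ≤ B(p′) (`abs_apply_le_sum`; the kernel expansion
  (Gf)(p) = Σ_{p′} (Gδ_{p′})(p)·f(p′) is the imported `B9Thm34Inv.apply_eq_sum_entry`, reused by name);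
* §2 (any finite pseudometric site space) LOCALIZED ROW SUMS WITH DECAY (`sum_localized_le`): if |f| ≤ m, f vanishes
  off X × Cp and R ≤ dist(x′, x) for every x′ ∈ X, then Σ_{p′} |f(p′)|·A·e^{−θ·dist(p′₁, x)} ≤
  A·m·e^{−(θ/2)R}·|Cp|·Σ_{x′} e^{−(θ/2)·dist(x, x′)} (half of the rate pays for the distance to the source, the
  other half for the summability); |Σ_j R(b)_{kj}g_j| ≤ Σ_j |g_j| for an isometric transport (`abs_sum_Rm_mul_le`,
  from the imported `B9Thm37GlueSz.abs_Rm_le_one`);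
* §3 THE TORUS (`UT N`, 1 ≤ M₀ ∣ N_i, sup torus distance): with the row sums `B4Sect5Torus.torusSum_le`
  (Σ_{x′} e^{−κ·dist(x, x′)} ≤ K_d(κ) uniformly in the periods) and the MODEL constant
  `supConst` B_T = (2/σ_T)·|Cp|·K_d(θ_T/2):
  **`sup_decay_torus`**: for every isometric transport, all weights in the ranges of `entry_decay_torus_explicit`,
  every site set X, every field f supported in X × Cp with |f| ≤ m, every point p and every R with
  R ≤ dist(x′, p₁) for all x′ ∈ X:  |((Δ_U + a·Q_UᵀQ_U)⁻¹f)(p)| ≤ B_T·e^{−(θ_T/2)·R}·m;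
  **`sup_bound_torus`** (X = everything, R = 0): ‖(Δ_U + a·Q_UᵀQ_U)⁻¹‖_{ℓ^∞ → ℓ^∞} ≤ B_T;
  **`covD_sup_decay_torus`**: |(∇_U (Δ_U + a·Q_UᵀQ_U)⁻¹f)(b, k)| ≤ c_max·(|Cp| + 1)·e^{θ_T/2}·B_T·e^{−(θ_T/2)·R}·m
  whenever R ≤ dist(x′, b₋) for all x′ ∈ X (the bond's endpoints are at distance ≤ 1, `B5Leibniz121.dist_up_le`).
  All constants depend on (d, M₀, a, c_min, c_max, w_min, w_max, |Cp|) only — UNIFORM in the torus and in U.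
  (Per source set X, `sup_decay_torus` has the binder shape of the sup-norm block majorants
  `B6RandomWalk.BlockSupp` / `B6RandomWalk.HasMajorant` of the [B6]/[B9] glue files; NO `B6.Geometry` instance for
  the torus blocks is constructed here and nothing downstream is discharged.)

HONEST SCOPE / NOT ASSERTED.  This is the lineage's ONE-STEP MODEL (one averaging Q_U over cubic blocks of side M₀
with a comb transport), not print's multiscale G′(U) of Theorem 3.1 (a sequence of averagings Q′_j(U) with the
weights of (3.16)/(3.24), the weighted distance d(y, y′) of (2.36) in [B9]'s reference [4], Hölder norms, and the
regularity condition (3.35) on U); print's constants δ₀, B₀ and print's random-walk proof are not asserted, approximated or used.  In the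
model NO regularity of U is needed (the transport enters `entry_decay_torus_explicit` only through isometries),
the distance is the sup torus distance of `B5TorusCover.UT` (print's d(y, y′) is the weighted contour distance of
(2.36) in [B9]'s reference [4] — at a single scale an ℓ¹-type path length, against which the sup distance differs by
at most a factor d; no comparison of rates with print is claimed), and the constants are crude (θ_T of
`B9Thm37GlueTorusCovCT.thetaTorus`; the factor |Cp|·K_d from summing the entrywise bound colour by colour); the
model is ONE scale on the UNIT lattice, so print's scale prefactors (L^jη)², L^jη have no counterpart (they are
absorbed in B_T).  The third and fourth entries of (3.42) (|G′∇\*_U λ|, |Δ_U G′λ|), the Hölder entries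
(3.43)–(3.45) and (3.46)–(3.47) are not modelled in this file.  value = kernel certificate (MODEL), NOT summit
progress; NOT continuum, NOT Clay.
-/

namespace Literature.MathematicalPhysics.QuantumFieldTheory.Balaban1983to89.B9Thm37GlueTorusCovSup

noncomputable section

open Finset B9Thm37Glue B9Thm37GluePU B9Thm37GlueTorusCov B9Thm37GlueTorusCovPoinc B9Thm37GlueTorusCovCT
open B5TorusCover (UT Ctr)
open B5Leibniz121 (up dist_up_le)
open B9Thm34Inv (entry apply_eq_sum_entry)

/-! ## §1  Row-sum domination of an endomorphism under an entrywise bound -/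

section Generic

variable {St Cp Bd : Type}

/-- **Row-sum domination**: an entrywise bound |(Gδ_{p′})(p)| ≤ B(p′) gives |(Gf)(p)| ≤ Σ_{p′} |f(p′)|·B(p′)
(kernel expansion `B9Thm34Inv.apply_eq_sum_entry`, `entry G p p′` = (Gδ_{p′})(p)). [folklore] -/
theorem abs_apply_le_sum [Fintype St] [DecidableEq St] [Fintype Cp] [DecidableEq Cp]
    (G : Module.End ℝ (St × Cp → ℝ)) (f : St × Cp → ℝ) (p : St × Cp) {Bk : St × Cp → ℝ}
    (hB : ∀ p', |G (Pi.single p' 1) p| ≤ Bk p') : |G f p| ≤ ∑ p', |f p'| * Bk p' := by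
  rw [apply_eq_sum_entry G f p]
  refine (Finset.abs_sum_le_sum_abs _ _).trans (Finset.sum_le_sum fun p' _ => ?_)
  rw [abs_mul, mul_comm]
  exact mul_le_mul_of_nonneg_left (show |entry G p p'| ≤ Bk p' from hB p') (abs_nonneg _)

/-! ## §2  Localized row sums with decay; sums against an isometric bond matrix -/

/-- **Localized row sums with decay** on a finite pseudometric site space: if |f| ≤ m (m ≥ 0), f vanishes off
X × Cp and R ≤ dist(x′, x) for all x′ ∈ X, then for A, θ ≥ 0
Σ_{p′} |f(p′)|·(A·e^{−θ·dist(p′₁, x)}) ≤ A·m·e^{−(θ/2)R}·(|Cp|·Σ_{x′} e^{−(θ/2)·dist(x, x′)}). [folklore] -/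
theorem sum_localized_le [PseudoMetricSpace St] [Fintype St] [Fintype Cp] {A θ m R : ℝ} (hA : 0 ≤ A)
    (hθ : 0 ≤ θ) (X : Finset St) (x : St) (hR : ∀ x' ∈ X, R ≤ dist x' x) (f : St × Cp → ℝ)
    (hfX : ∀ p', p'.1 ∉ X → f p' = 0) (hfm : ∀ p', |f p'| ≤ m) (hm : 0 ≤ m) :
    ∑ p', |f p'| * (A * Real.exp (-(θ * dist p'.1 x))) ≤
      A * m * Real.exp (-(θ / 2 * R)) * (Fintype.card Cp * ∑ x', Real.exp (-(θ / 2 * dist x x'))) := by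
  classical
  have hterm : ∀ p' : St × Cp, |f p'| * (A * Real.exp (-(θ * dist p'.1 x))) ≤
      A * m * Real.exp (-(θ / 2 * R)) * Real.exp (-(θ / 2 * dist x p'.1)) := by
    intro p'
    by_cases hx : p'.1 ∈ X
    · have hd : R ≤ dist p'.1 x := hR _ hx
      have he : Real.exp (-(θ * dist p'.1 x)) ≤
          Real.exp (-(θ / 2 * R)) * Real.exp (-(θ / 2 * dist x p'.1)) := by
        rw [← Real.exp_add, dist_comm x p'.1]
        apply Real.exp_le_exp.mpr
        have : θ / 2 * R ≤ θ / 2 * dist p'.1 x := mul_le_mul_of_nonneg_left hd (by linarith)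
        linarith
      calc |f p'| * (A * Real.exp (-(θ * dist p'.1 x)))
          ≤ m * (A * (Real.exp (-(θ / 2 * R)) * Real.exp (-(θ / 2 * dist x p'.1)))) :=
            mul_le_mul (hfm p') (mul_le_mul_of_nonneg_left he hA)
              (mul_nonneg hA (Real.exp_pos _).le) hm
        _ = A * m * Real.exp (-(θ / 2 * R)) * Real.exp (-(θ / 2 * dist x p'.1)) := by ring
    · rw [hfX p' hx, abs_zero, zero_mul]
      exact mul_nonneg (mul_nonneg (mul_nonneg hA hm) (Real.exp_pos _).le) (Real.exp_pos _).le
  calc ∑ p', |f p'| * (A * Real.exp (-(θ * dist p'.1 x)))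
      ≤ ∑ p' : St × Cp, A * m * Real.exp (-(θ / 2 * R)) * Real.exp (-(θ / 2 * dist x p'.1)) :=
        Finset.sum_le_sum fun p' _ => hterm p'
    _ = A * m * Real.exp (-(θ / 2 * R)) * ∑ p' : St × Cp, Real.exp (-(θ / 2 * dist x p'.1)) := by
        rw [Finset.mul_sum]
    _ = A * m * Real.exp (-(θ / 2 * R)) * (Fintype.card Cp * ∑ x', Real.exp (-(θ / 2 * dist x x'))) := by
        congr 1
        rw [Fintype.sum_prod_type, Finset.mul_sum]
        exact Finset.sum_congr rfl fun x' _ => by simp [Finset.sum_const, Finset.card_univ, nsmul_eq_mul]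

/-- |Σ_j R(b)_{kj} g_j| ≤ Σ_j |g_j| for an isometric transport (|R(b)_{kj}| ≤ 1, `B9Thm37GlueSz.abs_Rm_le_one`).
[folklore] -/
theorem abs_sum_Rm_mul_le [Fintype Cp] [DecidableEq Cp] (Rm : Bd → Cp → Cp → ℝ)
    (hRm : ∀ b i j, ∑ k, Rm b k i * Rm b k j = if i = j then (1 : ℝ) else 0) (b : Bd) (k : Cp) (g : Cp → ℝ) :
    |∑ j, Rm b k j * g j| ≤ ∑ j, |g j| :=
  (Finset.abs_sum_le_sum_abs _ _).trans (Finset.sum_le_sum fun j _ => by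
    rw [abs_mul]
    exact (mul_le_mul_of_nonneg_right (B9Thm37GlueSz.abs_Rm_le_one Rm hRm b k j) (abs_nonneg _)).trans
      (by rw [one_mul]))

end Generic

/-! ## §3  The torus: sup-norm, localized-source decay of (Δ_U + a·Q_UᵀQ_U)⁻¹ uniform in the volume and in U -/

section Torus

variable {d : ℕ} {N : Fin d → ℕ} [∀ i, NeZero (N i)] [NeZero d]

/-- **The MODEL constant** B_T(d, M₀, a, c_min, c_max, w_min, w_max; n_C) = (2/σ_T)·n_C·K_d(θ_T/2), n_C the number
of colour components, K_d = `B4Sect5Proof.latticeConst` (bookkeeping; independent of the torus and of U).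
[folklore] -/
def supConst (d M₀ : ℕ) (a wmin cmin cmax wmax : ℝ) (nC : ℕ) : ℝ :=
  2 / sigmaTorus d M₀ a wmin cmin *
    (nC * B4Sect5Proof.latticeConst d (thetaTorus d M₀ a wmin cmin cmax wmax / 2))

/-- B_T ≥ 0. [folklore] -/
theorem supConst_nonneg (d M₀ : ℕ) {a wmin : ℝ} (ha : 0 < a) (hwmin : 0 < wmin) (cmin cmax wmax : ℝ) (nC : ℕ) :
    0 ≤ supConst d M₀ a wmin cmin cmax wmax nC :=
  mul_nonneg (div_nonneg (by norm_num) (sigmaTorus_pos d M₀ ha hwmin cmin).le)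
    (mul_nonneg (Nat.cast_nonneg _)
      (B4Sect5Proof.latticeConst_nonneg d (half_pos (thetaTorus_pos d M₀ ha hwmin cmin cmax wmax)).le))

/-- **SUP-NORM, LOCALIZED-SOURCE DECAY OF (Δ_U + a·Q_UᵀQ_U)⁻¹ ON EVERY TORUS, UNIFORM IN THE VOLUME AND IN THE
TRANSPORT (MODEL of the first inequality of (3.42)).**  For every torus `UT N` with 1 ≤ M₀, M₀ ∣ N_i, every
isometric transport (hRm), bond weights c_min ≤ |c(b)| ≤ c_max (c_min > 0), block weights w_min ≤ |w(z)| ≤ w_max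
(w_min > 0), a > 0, every site set X, every field f vanishing off X × Cp with |f| ≤ m, every point p and every R
with R ≤ dist(x′, p₁) for all x′ ∈ X:  |((Δ_U + a·Q_UᵀQ_U)⁻¹f)(p)| ≤ B_T·e^{−(θ_T/2)·R}·m, with
B_T = `supConst d M₀ a wmin cmin cmax wmax |Cp|` and θ_T = `thetaTorus d M₀ a wmin cmin cmax wmax` > 0.
[cite: Balaban1985BackgroundPropagators, (3.42) p.397; (3.23)–(3.24) p.394; p.395] -/
theorem sup_decay_torus {Cp : Type} [Fintype Cp] [DecidableEq Cp] {M₀ : ℕ} (hM : 1 ≤ M₀)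
    (hdiv : ∀ i, M₀ ∣ N i) (c : UT N × Fin d → ℝ) {cmin cmax : ℝ} (hcmin : 0 < cmin) (hc : ∀ b, cmin ≤ |c b|)
    (hc' : ∀ b, |c b| ≤ cmax) (w : Ctr N M₀ → ℝ) {wmin wmax : ℝ} (hwmin : 0 < wmin) (hw : ∀ β, wmin ≤ |w β|)
    (hw' : ∀ β, |w β| ≤ wmax) (Rm : UT N × Fin d → Cp → Cp → ℝ)
    (hRm : ∀ b i j, ∑ k, Rm b k i * Rm b k j = if i = j then (1 : ℝ) else 0) {a : ℝ} (ha : 0 < a)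
    (X : Finset (UT N)) (f : UT N × Cp → ℝ) (hfX : ∀ p', p'.1 ∉ X → f p' = 0) {m : ℝ}
    (hfm : ∀ p', |f p'| ≤ m) (p : UT N × Cp) {R : ℝ} (hR : ∀ x' ∈ X, R ≤ dist x' p.1) :
    |Ring.inverse (covLapCov (torusComb hM hdiv) c w Rm a) f p| ≤
      supConst d M₀ a wmin cmin cmax wmax (Fintype.card Cp) *
        Real.exp (-(thetaTorus d M₀ a wmin cmin cmax wmax / 2 * R)) * m := by
  have hσ0 : 0 < sigmaTorus d M₀ a wmin cmin := sigmaTorus_pos d M₀ ha hwmin cmin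
  have hθ0 : 0 < thetaTorus d M₀ a wmin cmin cmax wmax := thetaTorus_pos d M₀ ha hwmin cmin cmax wmax
  have hA : 0 ≤ 2 / sigmaTorus d M₀ a wmin cmin := div_nonneg (by norm_num) hσ0.le
  have hm : 0 ≤ m := (abs_nonneg _).trans (hfm p)
  have h1 := abs_apply_le_sum (Ring.inverse (covLapCov (torusComb hM hdiv) c w Rm a)) f p
    (Bk := fun p' => 2 / sigmaTorus d M₀ a wmin cmin *
      Real.exp (-(thetaTorus d M₀ a wmin cmin cmax wmax * dist p'.1 p.1)))
    (fun p' => entry_decay_torus_explicit hM hdiv c hcmin hc hc' w hwmin hw hw' Rm hRm ha p' p)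
  have h2 := sum_localized_le (Cp := Cp) hA hθ0.le X p.1 hR f hfX hfm hm
  have h3 : ∑ x' : UT N, Real.exp (-(thetaTorus d M₀ a wmin cmin cmax wmax / 2 * dist p.1 x')) ≤
      B4Sect5Proof.latticeConst d (thetaTorus d M₀ a wmin cmin cmax wmax / 2) :=
    B4Sect5Torus.torusSum_le d (UT.one_le N) (half_pos hθ0) (UT.toSite N p.1)
  have hpre : 0 ≤ 2 / sigmaTorus d M₀ a wmin cmin * m *
      Real.exp (-(thetaTorus d M₀ a wmin cmin cmax wmax / 2 * R)) :=
    mul_nonneg (mul_nonneg hA hm) (Real.exp_pos _).le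
  calc |Ring.inverse (covLapCov (torusComb hM hdiv) c w Rm a) f p|
      ≤ _ := h1
    _ ≤ _ := h2
    _ ≤ 2 / sigmaTorus d M₀ a wmin cmin * m * Real.exp (-(thetaTorus d M₀ a wmin cmin cmax wmax / 2 * R)) *
          (Fintype.card Cp * B4Sect5Proof.latticeConst d (thetaTorus d M₀ a wmin cmin cmax wmax / 2)) :=
        mul_le_mul_of_nonneg_left (mul_le_mul_of_nonneg_left h3 (Nat.cast_nonneg _)) hpre
    _ = _ := by unfold supConst; ring

/-- **THE ℓ^∞ → ℓ^∞ OPERATOR NORM OF (Δ_U + a·Q_UᵀQ_U)⁻¹ IS BOUNDED UNIFORMLY IN THE VOLUME AND IN THE TRANSPORT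
(MODEL).**  |((Δ_U + a·Q_UᵀQ_U)⁻¹f)(p)| ≤ B_T·m whenever |f| ≤ m, for every torus, every isometric transport and all
weights in the stated ranges. [cite: Balaban1985BackgroundPropagators, (3.42) p.397; (3.23)–(3.24) p.394; p.395] -/
theorem sup_bound_torus {Cp : Type} [Fintype Cp] [DecidableEq Cp] {M₀ : ℕ} (hM : 1 ≤ M₀)
    (hdiv : ∀ i, M₀ ∣ N i) (c : UT N × Fin d → ℝ) {cmin cmax : ℝ} (hcmin : 0 < cmin) (hc : ∀ b, cmin ≤ |c b|)
    (hc' : ∀ b, |c b| ≤ cmax) (w : Ctr N M₀ → ℝ) {wmin wmax : ℝ} (hwmin : 0 < wmin) (hw : ∀ β, wmin ≤ |w β|)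
    (hw' : ∀ β, |w β| ≤ wmax) (Rm : UT N × Fin d → Cp → Cp → ℝ)
    (hRm : ∀ b i j, ∑ k, Rm b k i * Rm b k j = if i = j then (1 : ℝ) else 0) {a : ℝ} (ha : 0 < a)
    (f : UT N × Cp → ℝ) {m : ℝ} (hfm : ∀ p', |f p'| ≤ m) (p : UT N × Cp) :
    |Ring.inverse (covLapCov (torusComb hM hdiv) c w Rm a) f p| ≤
      supConst d M₀ a wmin cmin cmax wmax (Fintype.card Cp) * m := by
  have h := sup_decay_torus hM hdiv c hcmin hc hc' w hwmin hw hw' Rm hRm ha Finset.univ f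
    (fun p' hp' => absurd (mem_univ p'.1) hp') hfm p (R := 0) (fun x' _ => dist_nonneg)
  simpa using h

/-- **SUP-NORM, LOCALIZED-SOURCE DECAY OF THE COVARIANT DERIVATIVE OF THE SOLUTION (MODEL of the second inequality
of (3.42)).**  With G = (Δ_U + a·Q_UᵀQ_U)⁻¹ and f, X, m as in `sup_decay_torus`: for every bond b, colour k and
every R with R ≤ dist(x′, b₋) for all x′ ∈ X,
|(∇_U Gf)(b, k)| ≤ c_max·(|Cp| + 1)·e^{θ_T/2}·B_T·e^{−(θ_T/2)·R}·m  (the endpoints b₋, b₊ = b₋ + e_μ are at sup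
distance ≤ 1, so the bound at b₊ costs the factor e^{θ_T/2}; |R(b)_{kj}| ≤ 1 costs the factor |Cp|).
[cite: Balaban1985BackgroundPropagators, (3.42) p.397; (3.3) pp.390–391; (3.23)–(3.24) p.394] -/
theorem covD_sup_decay_torus {Cp : Type} [Fintype Cp] [DecidableEq Cp] {M₀ : ℕ} (hM : 1 ≤ M₀)
    (hdiv : ∀ i, M₀ ∣ N i) (c : UT N × Fin d → ℝ) {cmin cmax : ℝ} (hcmin : 0 < cmin) (hc : ∀ b, cmin ≤ |c b|)
    (hc' : ∀ b, |c b| ≤ cmax) (w : Ctr N M₀ → ℝ) {wmin wmax : ℝ} (hwmin : 0 < wmin) (hw : ∀ β, wmin ≤ |w β|)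
    (hw' : ∀ β, |w β| ≤ wmax) (Rm : UT N × Fin d → Cp → Cp → ℝ)
    (hRm : ∀ b i j, ∑ k, Rm b k i * Rm b k j = if i = j then (1 : ℝ) else 0) {a : ℝ} (ha : 0 < a)
    (X : Finset (UT N)) (f : UT N × Cp → ℝ) (hfX : ∀ p', p'.1 ∉ X → f p' = 0) {m : ℝ}
    (hfm : ∀ p', |f p'| ≤ m) (b : UT N × Fin d) (k : Cp) {R : ℝ} (hR : ∀ x' ∈ X, R ≤ dist x' (bsrc b)) :
    |covD bsrc btgt c Rm (Ring.inverse (covLapCov (torusComb hM hdiv) c w Rm a) f) (b, k)| ≤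
      cmax * (Fintype.card Cp + 1) * Real.exp (thetaTorus d M₀ a wmin cmin cmax wmax / 2) *
        (supConst d M₀ a wmin cmin cmax wmax (Fintype.card Cp) *
          Real.exp (-(thetaTorus d M₀ a wmin cmin cmax wmax / 2 * R)) * m) := by
  have hθ0 : 0 < thetaTorus d M₀ a wmin cmin cmax wmax := thetaTorus_pos d M₀ ha hwmin cmin cmax wmax
  have hB0 : 0 ≤ supConst d M₀ a wmin cmin cmax wmax (Fintype.card Cp) :=
    supConst_nonneg d M₀ ha hwmin cmin cmax wmax _
  have hm : 0 ≤ m := (abs_nonneg _).trans (hfm (bsrc b, k))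
  -- the distance from the source set to the far endpoint b₊ is at least R − 1
  have hR' : ∀ x' ∈ X, R - 1 ≤ dist x' (btgt b) := by
    intro x' hx'
    have h1 : dist x' (bsrc b) ≤ dist x' (btgt b) + dist (btgt b) (bsrc b) := dist_triangle _ _ _
    have h2 : dist (btgt b) (bsrc b) ≤ 1 := by
      obtain ⟨y, μ⟩ := b
      rw [btgt_apply, bsrc_apply, dist_comm]
      exact dist_up_le y μ
    linarith [hR x' hx']
  -- abbreviations
  have hW : ∀ q : UT N × Cp, ∀ R₀ : ℝ, (∀ x' ∈ X, R₀ ≤ dist x' q.1) →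
      |Ring.inverse (covLapCov (torusComb hM hdiv) c w Rm a) f q| ≤
        supConst d M₀ a wmin cmin cmax wmax (Fintype.card Cp) *
          Real.exp (-(thetaTorus d M₀ a wmin cmin cmax wmax / 2 * R₀)) * m :=
    fun q R₀ hq => sup_decay_torus hM hdiv c hcmin hc hc' w hwmin hw hw' Rm hRm ha X f hfX hfm q hq
  -- the common majorant W = B_T·e^{θ_T/2}·e^{−(θ_T/2)R}·m of the values at both endpoints
  have hexp1 : Real.exp (-(thetaTorus d M₀ a wmin cmin cmax wmax / 2 * (R - 1))) =
      Real.exp (thetaTorus d M₀ a wmin cmin cmax wmax / 2) *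
        Real.exp (-(thetaTorus d M₀ a wmin cmin cmax wmax / 2 * R)) := by
    rw [← Real.exp_add]; congr 1; ring
  have hexp2 : Real.exp (-(thetaTorus d M₀ a wmin cmin cmax wmax / 2 * R)) ≤
      Real.exp (thetaTorus d M₀ a wmin cmin cmax wmax / 2) *
        Real.exp (-(thetaTorus d M₀ a wmin cmin cmax wmax / 2 * R)) :=
    le_mul_of_one_le_left (Real.exp_pos _).le (Real.one_le_exp (half_pos hθ0).le)
  have htgt : ∀ j, |Ring.inverse (covLapCov (torusComb hM hdiv) c w Rm a) f (btgt b, j)| ≤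
      Real.exp (thetaTorus d M₀ a wmin cmin cmax wmax / 2) *
        (supConst d M₀ a wmin cmin cmax wmax (Fintype.card Cp) *
          Real.exp (-(thetaTorus d M₀ a wmin cmin cmax wmax / 2 * R)) * m) := by
    intro j
    refine (hW (btgt b, j) (R - 1) hR').trans (le_of_eq ?_)
    rw [hexp1]; ring
  have hsrc : |Ring.inverse (covLapCov (torusComb hM hdiv) c w Rm a) f (bsrc b, k)| ≤
      Real.exp (thetaTorus d M₀ a wmin cmin cmax wmax / 2) *
        (supConst d M₀ a wmin cmin cmax wmax (Fintype.card Cp) *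
          Real.exp (-(thetaTorus d M₀ a wmin cmin cmax wmax / 2 * R)) * m) := by
    refine (hW (bsrc b, k) R hR).trans ?_
    have := mul_le_mul_of_nonneg_right (mul_le_mul_of_nonneg_left hexp2 hB0) hm
    calc _ = supConst d M₀ a wmin cmin cmax wmax (Fintype.card Cp) *
          Real.exp (-(thetaTorus d M₀ a wmin cmin cmax wmax / 2 * R)) * m := rfl
      _ ≤ supConst d M₀ a wmin cmin cmax wmax (Fintype.card Cp) *
          (Real.exp (thetaTorus d M₀ a wmin cmin cmax wmax / 2) *
            Real.exp (-(thetaTorus d M₀ a wmin cmin cmax wmax / 2 * R))) * m := this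
      _ = _ := by ring
  set W := Real.exp (thetaTorus d M₀ a wmin cmin cmax wmax / 2) *
    (supConst d M₀ a wmin cmin cmax wmax (Fintype.card Cp) *
      Real.exp (-(thetaTorus d M₀ a wmin cmin cmax wmax / 2 * R)) * m) with hWdef
  have hW0 : 0 ≤ W := by rw [hWdef]; positivity
  have hcmax : 0 ≤ cmax := (abs_nonneg _).trans (hc' b)
  rw [covD_apply]
  calc |c (b, k).1 * (∑ j, Rm (b, k).1 (b, k).2 j *
          Ring.inverse (covLapCov (torusComb hM hdiv) c w Rm a) f (btgt (b, k).1, j) -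
          Ring.inverse (covLapCov (torusComb hM hdiv) c w Rm a) f (bsrc (b, k).1, (b, k).2))|
      ≤ cmax * (Fintype.card Cp * W + W) := by
        rw [abs_mul]
        refine mul_le_mul (hc' b) ?_ (abs_nonneg _) hcmax
        refine (abs_sub _ _).trans (add_le_add ?_ hsrc)
        refine (abs_sum_Rm_mul_le Rm hRm b k _).trans ?_
        calc ∑ j, |Ring.inverse (covLapCov (torusComb hM hdiv) c w Rm a) f (btgt b, j)|
            ≤ ∑ _j : Cp, W := Finset.sum_le_sum fun j _ => htgt j
          _ = Fintype.card Cp * W := by simp [Finset.sum_const, Finset.card_univ, nsmul_eq_mul]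
    _ = cmax * (Fintype.card Cp + 1) * Real.exp (thetaTorus d M₀ a wmin cmin cmax wmax / 2) *
          (supConst d M₀ a wmin cmin cmax wmax (Fintype.card Cp) *
            Real.exp (-(thetaTorus d M₀ a wmin cmin cmax wmax / 2 * R)) * m) := by
        rw [hWdef]; ring

end Torus

end

end Literature.MathematicalPhysics.QuantumFieldTheory.Balaban1983to89.B9Thm37GlueTorusCovSup
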